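import Summits.QuantumFields.BalabanUV.Beta.GAN24.SpureRecSlotChargeThreeFace
import Summits.QuantumFields.BalabanUV.Beta.GAN24.SandwichReadoutSiteDep
import Summits.QuantumFields.BalabanUV.Beta.GAN24.WardResidualRotatedVertexWeighted
import Summits.QuantumFields.BalabanUV.Beta.GAN24.StepResolventLegCharges

/-!
# `BalabanUV.Beta.GAN24.CubicSlotChargeOfLocal` — binder row G-an2-4 ∕ (CONV-C), TRANSFER-III, the (III′) (C)-campaign's supplier `hB0` AT LEVELS `≥ 1`, the MEMBER-GENERIC twin of leaf-04 g62's
# `SpureRecSlotChargeThreeFace.hasSum_legs_unitS_SpureRecAt_succ` («S3C-REC» ⟸ «3F-REC», clause (i)): **THE TWO-CONSTANT-LEG ff CONTRACTION OF THE UNIT-CHANGED CUBIC SECTOR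
# `unitS s_f s_m (C₀ • e3OfK Lc G_j S)` OF ANY LOCAL, `Lc`-BLOCK-COVARIANT MEMBER `S` IS `(s_f s_m)⁻¹ s_f⁻² · C₀ · (Lc·σ_j)³ ×` THE PERIOD-`Lc` THREE-FACE-LEGS CELL FORM OF `S`**
# (`σ_j = ((Lc^{j+1})^{d+2})⁻¹`, in-block root; leaf-04's proof VERBATIM with the member abstracted — it used only `locStencil_SrecAt` and `SrecAt_translate`).
# WHY: the comb member is `𝒯 S̃comb_j` (local, block-covariant — C §3), so the comb «S3C-REC» clause (i) reads the period-`Lc` three-face form of `𝒯 S̃comb_j`, which is that of `S̃comb_j`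
# (`ExitFaceWeightTransport.threeFace_transport_eq`) and vanishes by `CombThreeFaceRec` (next file).
# (G-an2-4 CRUX TEAM (2), leaf prover `b2b-balaban-gan24-formalise-leaf-01`, gen 87)

NOT IN PRINT; OUR BOOKKEEPING ([folklore] Fubini ∕ periodisation bookkeeping BY NAME, leaf-04 g62's; 0 `def`, 0 cited fact, 0 `def … : Prop`, 0 sorry).
HONEST FRAMING (cell contract, verbatim): «discharging `BetaPertH` makes Bałaban's UV stability UNCONDITIONAL — a real constructive-QFT result; it is NOT the continuum limit and NOT
the Clay problem.»  HONEST DEPENDENCY (verbatim): «continuum YM on T⁴ ⇐ BetaPertH ∧ nine spine estimates (0/9 proved); BetaPertH ⇐ (D1) ∧ (D4) ∧ CAP+tail; G-an2-4 gates asym, D1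
and NE2/3/4.»
WHAT: **`hasSum_legs_unitS_e3OfK_of_local`** (generic `d`, `[NeZero Lc]`, `1 ≤ Lc`, in-block root, every `j`, all units, any `C₀`, any local block-covariant `S`, every slot `(κ″, u″)`, field pair `(α, β)`).
NOT (Z)_comb; NOT `hB0`; NEVER «G-an2-4 closed» as (CONV-C); NOT D1, NOT `BetaPertH`, NOT continuum, NOT Clay.  2026-08-27; no existing file touched.
-/

noncomputable section

open Finset
open scoped BigOperators
open Literature.MathematicalPhysics.QuantumFieldTheory
open Literature.MathematicalPhysics.QuantumFieldTheory.Balaban1983to89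
open Literature.MathematicalPhysics.QuantumFieldTheory.Balaban1983to89.Beta
open B12Sec2to5 (l1)
open ExpKernelCalculus (Site MKer BiLoc Decays VertexFamily comp shiftK)
open AffineAveraging (box toSite)
open OneStepResolventKernel (Fib LocStencil wsum)
open OneStepKernelFamily (KInvStep colH vertexOfK abs_colH_le vertexFamily_vertexOfK' decays_KInvStep)
open BalabanStepJetsSucc (mmRead mmRead_inl_inl wE wVH)
open AveragingHessianKernels (packVH_inl_inl)
open Summit.QuantumFields.BalabanUV.Beta.HessKerDressedUnits (unitS unitS_apply)
open Summit.QuantumFields.BalabanUV.Beta.AxialDressingRooted (coDressKBmAt decays_coDressKBmAt_KInvStep shiftK_coDressKBmAt_KInvStep)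
open Summit.QuantumFields.BalabanUV.Beta.SpineRooted (e3OfK e3OfK_apply e3OfK_translate)
open Summit.QuantumFields.BalabanUV.Beta.GAN24.BiStencilZeroMode (tsum_mul_periodic)
open Summit.QuantumFields.BalabanUV.Beta.GAN24.SandwichReadoutSiteDep (hasSum_sandwich_readout_coDressKBmAt hasSum_coDressKBmAt_col)
open Summit.QuantumFields.BalabanUV.Beta.GAN24.StepResolventLegCharges (hasSum_KInvStep_inr_inl hasSum_KInvStep_inl_inr)
open Summit.QuantumFields.BalabanUV.Beta.GAN24.MultiplierZeroMass (hasSum_KInvStep_mm_left hasSum_KInvStep_mm_right)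
open Summit.QuantumFields.BalabanUV.Beta.GAN24.WilsonVertexTwoConst (unitS_inl_inl)
open Summit.QuantumFields.BalabanUV.Beta.SecondOrderUnits (unitS₂)
open Summit.QuantumFields.BalabanUV.Beta.SpineRooted (T2RecOf T2RecAt M1At)
open Summit.QuantumFields.BalabanUV.Beta.GAN24.CombesThomas (sfStep smStep)
open Summit.QuantumFields.BalabanUV.Beta.GAN24.BiStencilZeroMode (Tab zmode)
open AveragingMixedJetTables (mixFFAt)
open BalabanCompositeJets (LocStencil₂)
open RemainderConstAllScales (AllScalesSeq)
open OneStepKernelFamily (TbalOf)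
open AveragingContoursRooted (ctrOff ctrOff_mem_box)
open WilsonVertex2Sym (wsym22)
open Summit.QuantumFields.BalabanUV.Beta.AxialDressingRooted (dressKBmAt coProjBmAtK)
open Summit.QuantumFields.BalabanUV.Beta.SecondOrderSocketIdentification (vh₂SAn1)
open Summit.QuantumFields.BalabanUV.Beta.RowD1JointEnd (JsRowD1Pin)
open Summit.QuantumFields.BalabanUV.Beta.GAN24.WardResidualRotatedVertexWeighted (hasSum_weighted_vertexOfK)
namespace Summit.QuantumFields.BalabanUV.Beta.GAN24.CubicSlotChargeOfLocal

open Summit.QuantumFields.BalabanUV.Beta.GAN24.SpureRecSlotChargeThreeFace (tsum_weighted_periodic hasSum_colH_coset sum_sum_face_collapse ite_eq_mul_indicator face_periodic)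

variable {d : ℕ} {Lc : ℕ} [NeZero Lc]

/-- NOT IN PRINT; OUR BOOKKEEPING ([folklore]; leaf-04 g62's `hasSum_legs_unitS_SpureRecAt_succ` with the member abstracted).  For `G_j = coDressKBmAt ρ Lc (KInvStep Lc j)`, in-block root,
ANY local `Lc`-block-covariant `S`, all units, any scalar `C₀`, every slot `(κ″, u″)` and field pair `(α, β)`:
`Σ_{(x,z)} unitS s_f s_m (C₀ • e3OfK Lc G_j S) κ″ u″ x z (inl α)(inl β) = (s_f s_m)⁻¹ s_f⁻² · C₀ · (Lc·σ_j)³ · Σ_{v ∈ box} [v_{κ″} % Lc = Lc−1]·Σ'_{(y,w)} [y_α face][w_β face]·S κ″ v y w (inl α)(inl β)`. -/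
theorem hasSum_legs_unitS_e3OfK_of_local (hLc : 1 ≤ Lc) {r : Fin (d + 1) → ℕ} (hr : r ∈ box (d + 1) Lc)
    {S : Fin (d + 1) → Site (d + 1) → MKer (d + 1) (Fib d)} {Cs δs : ℝ} (hSl : LocStencil S Cs δs) (hδs : 0 < δs)
    (hScov : ∀ (κ : Fin (d + 1)) (u t : Site (d + 1)), S κ (u + (Lc : ℤ) • t) = shiftK (-((Lc : ℤ) • t)) (S κ u))
    (sf sm C₀ : ℝ) (j : ℕ) (κ'' : Fin (d + 1)) (u'' : Site (d + 1)) (α β : Fin (d + 1)) :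
    HasSum (fun p : Site (d + 1) × Site (d + 1) =>
        unitS sf sm (fun κ t => C₀ • e3OfK Lc (coDressKBmAt (toSite r) Lc (KInvStep (d := d) Lc j)) S κ t) κ'' u'' p.1 p.2 (Sum.inl α) (Sum.inl β))
      ((sf * sm)⁻¹ * (sf⁻¹ * sf⁻¹) * C₀ * ((Lc : ℝ) * ((((Lc ^ (j + 1) : ℕ) : ℝ)) ^ (d + 1 + 1))⁻¹) ^ 3 *
        ∑ v ∈ box (d + 1) Lc, (if toSite v κ'' % (Lc : ℤ) = (Lc : ℤ) - 1 then (1 : ℝ) else 0) *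
          ∑' yw : Site (d + 1) × Site (d + 1),
            (if yw.1 α % (Lc : ℤ) = (Lc : ℤ) - 1 then (1 : ℝ) else 0) * (if yw.2 β % (Lc : ℤ) = (Lc : ℤ) - 1 then (1 : ℝ) else 0) *
              S κ'' (toSite v) yw.1 yw.2 (Sum.inl α) (Sum.inl β)) := by
  -- abbreviations
  set σ : ℝ := ((((Lc ^ (j + 1) : ℕ) : ℝ)) ^ (d + 1 + 1))⁻¹ with hσ
  set K : MKer (d + 1) (Fib d) := KInvStep (d := d) Lc j with hK
  set G : MKer (d + 1) (Fib d) := coDressKBmAt (toSite r) Lc K with hG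
  set V : MKer (d + 1) (Fib d) := vertexOfK G Lc S κ'' u'' with hV
  set U : ℝ := (sf * sm)⁻¹ * (sf⁻¹ * sf⁻¹) * C₀ with hU
  have hσ0 : 0 ≤ σ := by rw [hσ]; positivity
  have hLσ : 0 ≤ (Lc : ℝ) * σ := mul_nonneg (Nat.cast_nonneg _) hσ0
  -- the two face weights of the legs and their product
  set fL : Site (d + 1) → ℝ := fun y => if y α % (Lc : ℤ) = (Lc : ℤ) - 1 then (Lc : ℝ) * -σ else 0 with hfL
  set fR : Site (d + 1) → ℝ := fun w => if w β % (Lc : ℤ) = (Lc : ℤ) - 1 then (Lc : ℝ) * σ else 0 with hfR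
  set ω : Site (d + 1) × Site (d + 1) → ℝ := fun yw => fL yw.1 * fR yw.2 with hω
  have hωb : ∀ yw : Site (d + 1) × Site (d + 1), |ω yw| ≤ (Lc : ℝ) * σ * ((Lc : ℝ) * σ) := by
    intro yw
    have h1 : |fL yw.1| ≤ (Lc : ℝ) * σ := by
      simp only [hfL]
      split_ifs
      · rw [mul_neg, abs_neg, abs_of_nonneg hLσ]
      · rw [abs_zero]; exact hLσ
    have h2 : |fR yw.2| ≤ (Lc : ℝ) * σ := by
      simp only [hfR]
      split_ifs
      · rw [abs_of_nonneg hLσ]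
      · rw [abs_zero]; exact hLσ
    simp only [hω]
    rw [abs_mul]
    exact mul_le_mul h1 h2 (abs_nonneg _) hLσ
  have hωp : ∀ (yw : Site (d + 1) × Site (d + 1)) (t : Site (d + 1)), ω (yw.1 + (Lc : ℤ) • t, yw.2 + (Lc : ℤ) • t) = ω yw := by
    intro yw t
    simp only [hω, hfL, hfR, face_periodic]
  -- decay ∕ localisation data
  obtain ⟨δK, CK, hδK, -, hKd⟩ := decays_KInvStep (d := d) (Lc := Lc) j
  obtain ⟨δG, CG, hδG, hCG, hGd⟩ := decays_coDressKBmAt_KInvStep (d := d) hr j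
  obtain ⟨Cv, δv, hδv, hVF⟩ := vertexFamily_vertexOfK' (N := Lc) ⟨δG, CG, hδG, hCG, hGd⟩ hSl hδs
  have hVb : BiLoc V ((Lc : ℤ) • u'') ((Lc : ℤ) • u'') Cv δv := hVF κ'' u''
  have hGs : ∀ t : Site (d + 1), shiftK (-((Lc : ℤ) • t)) G = G := fun t => shiftK_coDressKBmAt_KInvStep (d := d) (toSite r) j t
  have hSt : ∀ (κ : Fin (d + 1)) (u t : Site (d + 1)), S κ (u + (Lc : ℤ) • t) = shiftK (-((Lc : ℤ) • t)) (S κ u) := hScov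
  -- the raw step kernel's site-free charges ((Q-lin) ∕ (S2c) BY NAME)
  have hL : ∀ (t : Site (d + 1)) (α' κ : Fin (d + 1)), HasSum (fun x' : Site (d + 1) => K ((Lc : ℤ) • x') t (Sum.inr α') (Sum.inl κ))
      ((fun α' κ => -(if κ = α' then σ else 0)) α' κ) := fun t α' κ => hasSum_KInvStep_inr_inl j α' κ t
  have hL0 : ∀ (t : Site (d + 1)) (α' m : Fin (d + 1)), HasSum (fun x' : Site (d + 1) => K ((Lc : ℤ) • x') t (Sum.inr α') (Sum.inr m)) 0 :=
    fun t α' m => hasSum_KInvStep_mm_left j α' m t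
  have hR : ∀ (u : Site (d + 1)) (κ μ : Fin (d + 1)), HasSum (fun y : Site (d + 1) => K u ((Lc : ℤ) • y) (Sum.inl κ) (Sum.inr μ))
      ((fun κ μ => if κ = μ then σ else 0) κ μ) := fun u κ μ => hasSum_KInvStep_inl_inr j κ μ u
  have hR0 : ∀ (u : Site (d + 1)) (m μ : Fin (d + 1)), HasSum (fun y : Site (d + 1) => K u ((Lc : ℤ) • y) (Sum.inr m) (Sum.inr μ)) 0 :=
    fun u m μ => hasSum_KInvStep_mm_right j m μ u
  -- (A) the sandwich read-out through the comb kernel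
  have hsand := hasSum_sandwich_readout_coDressKBmAt (N := Lc) hLc hr hKd hδK hVb hδv α β hL hL0 hR hR0
  -- (B) collapse of the fibre sums to (α, β)
  have hcoll : ∀ yw : Site (d + 1) × Site (d + 1),
      (∑ a : Fin (d + 1), ∑ b : Fin (d + 1),
        (if yw.1 a % (Lc : ℤ) = (Lc : ℤ) - 1 then (Lc : ℝ) * (fun α' κ => -(if κ = α' then σ else 0)) α a else 0) *
          V yw.1 yw.2 (Sum.inl a) (Sum.inl b) *
          (if yw.2 b % (Lc : ℤ) = (Lc : ℤ) - 1 then (Lc : ℝ) * (fun κ μ => if κ = μ then σ else 0) b β else 0))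
        = ω yw * V yw.1 yw.2 (Sum.inl α) (Sum.inl β) := by
    intro yw
    simp only []
    rw [sum_sum_face_collapse j V α β yw.1 yw.2]
  -- (C) the weighted chain-rule vertex Fubini
  have hw : ∀ (κ : Fin (d + 1)) (t : Site (d + 1)), |colH G Lc κ'' u'' κ t| ≤ CG * Real.exp (-δG * l1 (t - (Lc : ℤ) • u'')) :=
    fun κ t => abs_colH_le (N := Lc) hGd κ'' u'' κ t
  have hvert := hasSum_weighted_vertexOfK (N := Lc) (K' := G) κ'' u'' hw hδG hSl hδs (Sum.inl α) (Sum.inl β) (ω := ω) hωb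
  -- the slot function g κ t := Σ' ω·S κ t … and its periodicity
  have hg : ∀ (κ : Fin (d + 1)) (u t : Site (d + 1)),
      (∑' yw : Site (d + 1) × Site (d + 1), ω yw * S κ (u + (Lc : ℤ) • t) yw.1 yw.2 (Sum.inl α) (Sum.inl β))
        = ∑' yw : Site (d + 1) × Site (d + 1), ω yw * S κ u yw.1 yw.2 (Sum.inl α) (Sum.inl β) :=
    fun κ u t => tsum_weighted_periodic (N := Lc) hSt hωp κ u t (Sum.inl α) (Sum.inl β)
  -- (F) periodisation of each slot sum, (G) the coset column totals
  have hper : ∀ κ : Fin (d + 1),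
      (∑' t : Site (d + 1), colH G Lc κ'' u'' κ t * ∑' yw : Site (d + 1) × Site (d + 1), ω yw * S κ t yw.1 yw.2 (Sum.inl α) (Sum.inl β))
        = ∑ v ∈ box (d + 1) Lc, (∑' yw : Site (d + 1) × Site (d + 1), ω yw * S κ (toSite v) yw.1 yw.2 (Sum.inl α) (Sum.inl β)) *
            (if toSite v κ % (Lc : ℤ) = (Lc : ℤ) - 1 then (Lc : ℝ) * (if κ = κ'' then σ else 0) else 0) := by
    intro κ
    rw [tsum_mul_periodic (N := Lc) (fun u t => hg κ u t) (hvert.2 κ)]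
    refine Finset.sum_congr rfl fun v _ => ?_
    congr 1
    have hc := hasSum_coDressKBmAt_col (N := Lc) hLc hr hR hR0 κ'' (Sum.inl κ) (toSite v)
    simp only [Sum.elim_inl] at hc
    exact (hasSum_colH_coset hGs hc u'').tsum_eq
  -- (H) assemble: the value of the sandwich read-out
  have hval : (∑' yw : Site (d + 1) × Site (d + 1), ∑ a : Fin (d + 1), ∑ b : Fin (d + 1),
        (if yw.1 a % (Lc : ℤ) = (Lc : ℤ) - 1 then (Lc : ℝ) * (fun α' κ => -(if κ = α' then σ else 0)) α a else 0) *
          V yw.1 yw.2 (Sum.inl a) (Sum.inl b) *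
          (if yw.2 b % (Lc : ℤ) = (Lc : ℤ) - 1 then (Lc : ℝ) * (fun κ μ => if κ = μ then σ else 0) b β else 0))
      = ∑ v ∈ box (d + 1) Lc, (∑' yw : Site (d + 1) × Site (d + 1), ω yw * S κ'' (toSite v) yw.1 yw.2 (Sum.inl α) (Sum.inl β)) *
          (if toSite v κ'' % (Lc : ℤ) = (Lc : ℤ) - 1 then (Lc : ℝ) * σ else 0) := by
    rw [tsum_congr hcoll, hvert.1.tsum_eq, Finset.sum_eq_single κ'']
    · rw [hper κ'']
      simp only [if_true]
    · intro κ _ hκ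
      rw [hper κ]
      refine Finset.sum_eq_zero fun v _ => ?_
      simp only [hκ, if_false, mul_zero, ite_self]
    · intro h; exact absurd (Finset.mem_univ κ'') h
  -- (I) scalars
  have hgv : ∀ v : Fin (d + 1) → ℕ,
      (∑' yw : Site (d + 1) × Site (d + 1), ω yw * S κ'' (toSite v) yw.1 yw.2 (Sum.inl α) (Sum.inl β))
        = ((Lc : ℝ) * -σ) * ((Lc : ℝ) * σ) * ∑' yw : Site (d + 1) × Site (d + 1),
            (if yw.1 α % (Lc : ℤ) = (Lc : ℤ) - 1 then (1 : ℝ) else 0) * (if yw.2 β % (Lc : ℤ) = (Lc : ℤ) - 1 then (1 : ℝ) else 0) *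
              S κ'' (toSite v) yw.1 yw.2 (Sum.inl α) (Sum.inl β) := by
    intro v
    rw [← tsum_mul_left]
    refine tsum_congr fun yw => ?_
    simp only [hω, hfL, hfR]
    rw [ite_eq_mul_indicator (yw.1 α % (Lc : ℤ) = (Lc : ℤ) - 1) ((Lc : ℝ) * -σ),
      ite_eq_mul_indicator (yw.2 β % (Lc : ℤ) = (Lc : ℤ) - 1) ((Lc : ℝ) * σ)]
    ring
  have hpt : ∀ p : Site (d + 1) × Site (d + 1),
      unitS sf sm (fun κ t => C₀ • e3OfK Lc (coDressKBmAt (toSite r) Lc (KInvStep (d := d) Lc j)) S κ t) κ'' u'' p.1 p.2 (Sum.inl α) (Sum.inl β)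
        = -U * comp (comp G V) G ((Lc : ℤ) • p.1) ((Lc : ℤ) • p.2) (Sum.inr α) (Sum.inr β) := by
    intro p
    rw [unitS_inl_inl]
    simp only [Pi.smul_apply, smul_eq_mul, e3OfK_apply, mmRead_inl_inl, hU, hV, hG, hK]
    ring
  have hfin := hsand.mul_left (-U)
  rw [hval] at hfin
  have hfin' : HasSum (fun p : Site (d + 1) × Site (d + 1) =>
      unitS sf sm (fun κ t => C₀ • e3OfK Lc (coDressKBmAt (toSite r) Lc (KInvStep (d := d) Lc j)) S κ t) κ'' u'' p.1 p.2 (Sum.inl α) (Sum.inl β))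
      (-U * ∑ v ∈ box (d + 1) Lc, (∑' yw : Site (d + 1) × Site (d + 1), ω yw * S κ'' (toSite v) yw.1 yw.2 (Sum.inl α) (Sum.inl β)) *
          (if toSite v κ'' % (Lc : ℤ) = (Lc : ℤ) - 1 then (Lc : ℝ) * σ else 0)) := by
    refine hfin.congr_fun fun p => ?_
    rw [hpt p]
  convert hfin' using 1
  rw [Finset.mul_sum, Finset.mul_sum]
  refine Finset.sum_congr rfl fun v _ => ?_
  rw [hgv v, ite_eq_mul_indicator (toSite v κ'' % (Lc : ℤ) = (Lc : ℤ) - 1) ((Lc : ℝ) * σ)]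
  ring

end Summit.QuantumFields.BalabanUV.Beta.GAN24.CubicSlotChargeOfLocal

end
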